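import Summits.BirchSwinnertonDyer.BirchSwinnertonDyer.Theses.UniversalToricDescent
import Summits.BirchSwinnertonDyer.BirchSwinnertonDyer.Theorems.EisensteinPrimesHidaLimitFittingBoundConverse
import Summits.BirchSwinnertonDyer.Rank1Residual.X11b.BDPRouteOpenInputDegenerateFrame
import Literature.NumberTheory.EllipticCurves.CyclotomicIwasawaMainTheoremIrreducibleProofs
import Mathlib.RingTheory.PowerSeries.Derivative
import HarnessLib

/-!
# NODE (D-0171) on crux stmt-BirchSwinnertonDyer-24207 `UniversalToricDescent.RationalSplitIMCInclusionAtThree`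
# — idea `frozen-channel-padic-pin` (crux-ideate seat `cruxidea-stmt-BirchSwinnertonDyer-24207-1` gen 9, 2026-08-30)

KIND: DECOMPOSITION through ROOT-WISE DOORS + a CORRECTION of the gen-8 structure theorem (B-g8-1 is repaired to
B-g9-1 below: the UN-derived anti-diagonal class is ALIVE).  The wall `∃ k, 3ᵏ·L ∈ Ch_Λ(X_(∅,0))·R₀⟦T⟧` (RATWALL;
`X = XAc … 𝔭' ∅` strict at `𝔭'`, relaxed at the branch prime `𝔭` of `ι'`; O6 rows, `ρ̄₃` onto, `r_an = 1`,
`3 = 𝔭𝔭'` split in the Heegner field) is entered through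

  **S9 (pinned content supply)** ∧ **Rc** ∧ **St** ∧ **R (root-wise door)** ⟹ 24207     (kernel, BY NAME, below):

* **S9** `PinnedContentSupplyAtThree` [UNDECIDED · door-half · EQUIV-mod-(R,Rc,St) with the wall — costume check
  `pinnedContentSupply_of_wall`]: on the wall's binders, with `X` torsion and `Ch·R₀⟦T⟧ = (F)`, there are `a`, a
  CONTENT `c ∈ R₀⟦T⟧` and a cofactor `M` root-disjoint from `F` with `F ∣ 3ᵃ·c` and `ord_x c ≤ ord_x (M·L)` at every
  point of the open disc.  (`c` = content of `loc_𝔭 𝐳` of the class below; `M` = the frozen-channel `p`-adic value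
  `C ∈ R₀ ∖ {0}` times the local triple-product factor at `3`; `ord_x c ≤ ord_x(M·L)` = the reciprocity law read in the
  tempered ring, where DIVISIBILITY is not available but ORDERS OF VANISHING are.)
* **Rc** `RootwiseDoorConverse` [WEAKER · ATTACKABLE (S)] `F ∣ 3ᵏ·G ⟹ ord_x F ≤ ord_x G` (Leibniz; `3ᵏ` has no disc zero).
* **St** `RootwiseCoprimeStripping` [WEAKER · ATTACKABLE (M)] `ord_x F ≤ ord_x(M·L)` and `Z(F) ∩ Z(M) = ∅` ⟹
  `ord_x F ≤ ord_x L` (`ord_x(M·L) = ord_x M + ord_x L` over the field `ℂ₃`, Leibniz).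
* **R** `RootwiseDoor` [WEAKER · ATTACKABLE (M) · verbatim the gen-6 door, shared] `F ≠ 0`, `ord_x F ≤ ord_x L` on the
  open disc ⟹ `F ∣ 3ᵏ·L` in `R₀⟦T⟧` (Weierstrass preparation over the complete DVR `R₀ = 𝒪(ℚ̂₃^ur)`).
* **P** `DiscZerosFinite` [WEAKER · ATTACKABLE (M) · ASIDE, feeds producer step (P)] a nonzero `G ∈ R₀⟦T⟧` has finitely
  many zeros in the open disc (Weierstrass preparation; units of `R₀⟦T⟧` have none).

## THE LEVER (informal producer of S9; technique-differentiated from the ten cards on file — it UN-DERIVES gen 8)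

**Frozen-channel `p`-adic pin.**  Take ONE CM Hida family `𝐠 = θ_β(S)` of `K` (`β` a ring-class character of
conductor prime to `3N`, `β² ≢ 1` so `θ_β` is cuspidal and residually non-Eisenstein) in BOTH moving slots and FREEZE
`f = f_E` (level `27N'`, `U₃f = 0`): the `f`-frozen two-variable diagonal class `𝐙(f,𝐠,𝐠')` over `𝒪⟦S₁,S₂⟧`
(Castella–Do arXiv:2303.06751 §2.2–2.4 package exactly this "`κ(f,gh)` with `f` FIXED", pp. 3, 19).  After the
self-dual twist its `G_K`-decomposition is (CD p. 37, `Ψ^{1−c}_{W₁}, Ψ^{1−c}_{W₂}`):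
  `V_f ⊗ [β²·Ψ_{(s+t)/2}^{1−c}]` (channel **A**, moves with `u = s+t`) ⊕ `V_f ⊗ [Ψ_{(s−t)/2}^{1−c}]` (channel **B**,
  moves with `v = s−t` = OUR anticyclotomic line through `𝟙`).
On the ANTI-DIAGONAL `u = 0` (weights `(2, 1+s, 1−s)`; only `(2,1,1)` classical) channel A is FROZEN at the
finite-order character `ν := β²` and channel B sweeps the Heegner line: `𝐳 := 𝐙_B|_{u=0} ∈ H¹(K, T⊗Λ_ac)`.
(F) FACTORISATION with a `p`-ADIC constant [ATTACKABLE (L) given a two-variable toric function = LEAD stub K3a♯, shared;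
    INSTRUMENTABLE: F-g8-1 local trilinear integral at 3].  `(L_p^𝐠)² = 𝓛₂(f/K)(A-char)·𝓛₂(f/K)(B-char)·fudge` as
    TWO-variable functions (Artin formalism `L(f⊗θ⊗θ') = L(f/K,A)·L(f/K,B)` at the dense `𝐠`-dominant crystalline
    points, where BOTH channels have infinity type in the BDP range `Σ⁽²⁾`, sign `+1`); restricting to `u = 0`:
        `(L_p^𝐠|_{u=0})² = C · fudge|_{u=0} · L`,   `C := 𝓛^{BDP}_{ν-branch}(ν_wild)`  — a `p`-ADIC VALUE of the
    `ν`-branch BDP function at a torsion point, OUTSIDE its interpolation range (by BDP/Liu–Zhang–Zhang it is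
    `unit·log_ω(y_ν)²`; tree: `Literature.NumberTheory.EllipticCurves.LiuZhangZhang2018.PAdicWaldspurgerEllipticCurveAdditive`),
    NOT the complex central value `L(f/K,ν,1) = 0` of sign `−1`.  This is the gen-8 error: see B-g9-1.
(P) PIN IS FREE [ATTACKABLE (M), typed `DiscZerosFinite` + Cornut–Vatsal non-vanishing of the `ν`-branch]: the branch
    function is a nonzero element of `R₀⟦T⟧`, so all but finitely many `3`-power-order `ν_wild` give `C ≠ 0`; no Heegner
    point, height or `p`-adic Waldspurger formula is needed for `C ≠ 0` (they only IDENTIFY `C`).  Hence the gen-8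
    DOOR D (coprime cofactor) degenerates to a constant, and the DERIVED class / derivative leaf D' disappear.
(S1) [paper proof, ATTACKABLE (S) once compact Selmer modules are typed] `S_(0_𝔭,∅_𝔭') = 0` when `X_(∅,0)` is torsion:
    Euler–Poincaré `rk S_ℱ − rk X_{ℱ*} = Σ_{v∣3} rk ℱ_v − 2 = −2 + rk X …`; precisely `rk S_(0,∅) = rk X_(∅,0) + 0 = 0` and
    `H¹_Iw` is torsion-free (`E(K_∞)[3] = 0` from `ρ̄₃` onto).  (Checked against the ordinary Heegner model: `c ∈ S_(0,∅)`
    pairs to `0` with `loc_𝔭' κ_∞` under local Tate duality summed over `v ∣ 3`, forcing `c ∈ S_(0,Gr) ⊂ S_(Gr,Gr) = `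
    rank one `∋ κ_∞` with `loc_𝔭 κ_∞ ≠ 0`, so `c` is torsion, so `0`.)
(A) CONTENT BOUND [UNDECIDED · IDEA-NEEDED on the exact shape, ask A-g9-1; machine = SPLIT-prime Kolyvagin systems
    (Jetchev–Nekovář–Skinner; Castella–Do §3.3) for the `τ`-ASYMMETRIC core-rank-one structure `G := (L_𝔭, ∅_𝔭')`,
    `L_𝔭 := sat(Λ·loc_𝔭 𝐳) = Λ·ℓ`, `ℓ` a primitive vector of `H¹_Iw(K_𝔭,T) ≅ Λ²`]: Poitou–Tate for `(0,∅) ⊂ (L,∅)` with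
    (S1) gives `0 → S_(L,∅) → L_𝔭 → X_(∅,0) → X_(L^⊥,0) → 0`, `rk S_(L,∅) = 1`, `X_(L^⊥,0)` torsion, and
    `char X_(∅,0) = char(L_𝔭/loc_𝔭 S_(L,∅)) · char X_(L^⊥,0)`; the KS bound `char X_(L^⊥,0) ∣ 3ᵃ·ind(𝐳; S_(L,∅))` then
    yields `char X_(∅,0) ∣ 3ᵃ·cont_𝔭(𝐳)` (`cont` = gcd of the two coordinates of `loc_𝔭 𝐳`; BASIS-FREE, evades
    `JacquetVanishingNoLocalLine`).  The tame (split-prime) norm relations of `𝐙` are CD Prop. 2.3.1 (twists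
    `(βα, α⁻¹)`, `α` of `λ`-power conductor, `ℓ = λλ̄` split), independent of the ordinarity of `f`.  CAVEAT B-g9-2.
(R) RANK-TWO TEMPERED RECIPROCITY [IDEA-NEEDED · hardest · research]: a Λ-linear functional
    `λ_ω : H¹_Iw(K_𝔭, T) → 𝓗_{1/2}(Γ^ac)⊗R₀` (big dual exponential paired with `ω_f` for the de Rham, potentially
    supersingular `V_f|G_{ℚ₃}` over the local anticyclotomic tower, which is the `ℤ₃`-part of a Lubin–Tate tower of `ℚ₃`
    for a uniformiser `π₀ ∈ 3ℤ₃^×` — Colmez 1998 / Berger–Fourquaux / Schneider–Venjakob regulator maps; order `½` from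
    the slopes `½,½`) with `λ_ω(loc_𝔭 𝐳) = e·L_p^𝐠|_{u=0}`.  It must read the FULL rank-two local cohomology (no `F⁺V_f`:
    K1, `PotentiallySupersingularNoStableLine`); the known proofs (BSV, DR, CD Thm. 3.4.1) read an `F⁺`-graded rank-one
    piece and compute `p`-adic Abel–Jacobi images at balanced points on `X₁(Np)³` with `p ∤ N` — here `27 ∣ N`, bad
    reduction at 3, no Besser/Coleman model: THIS is the research content of the line.  Since `cont_𝔭(𝐳) ∣ λ_ω(loc_𝔭 𝐳)`
    coordinate-wise and `λ_ω(ℓ)` is ANALYTIC on the open disc, (A)+(R)+(F) give `ord_x(char X) ≤ ord_x(cont) ≤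
    ord_x(L_p^𝐠|_{u=0}) = ½·ord_x(C·fudge·L) ≤ ord_x(M·L)` — i.e. S9 with `c = cont_𝔭(𝐳)`, `M = C·fudge|_{u=0}`.
(E1') [IDEA-NEEDED · geometric, shared with gen 8] existence and bounded denominators of the `f`-frozen two-variable
    class at `27 ∣ N_f`: BSV `Det`-packaging at FIXED level `Γ₁(N'd_K)∩Γ₀(27)` with trivial coefficients in the `f`-slot
    (`f`-isotypic projection costs only the congruence number — fits the RATIONAL wall) and `e_ord` on the two CM slots
    only (`e_ord` kills the `27`-old copies `g_α(q³), g_α(q⁹)`); no cycle tower on `f` (B-g8-2 stands).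

WHY NOVEL (one sentence): every card on file either needs a Heegner/toric OBJECT on the line (K1, g4, g6-B/C), a family
THROUGH `f_E` (LEAD comb teeth, g2, g7), or — gen 8 — DERIVES the diagonal class because it believed the frozen channel
kills it; here the Heegner point is DEMOTED TO A SCALAR (`C`, pinned nonzero by Weierstrass finiteness alone), the class
is un-derived, and the only functional needed is at the branch prime `𝔭` on rank-two local cohomology.

## B-g9-1 — CORRECTION of B-g8-1 (answers Q-g8-1; which member of the "tetrad" fails)
(S1) HOLDS (proof above).  (S3) holds.  What FAILS in gen 8's corollary is the premise "both channel central values have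
sign −1 ⇒ `L_p^𝐠|_{line} = 0` ⇒ the un-derived specialisations are crystalline": on `u = 0` the frozen channel
contributes the `p`-ADIC value `𝓛^{BDP}(ν) ≠ 0` (outside interpolation; the sign-`−1` vanishing is of the COMPLEX value,
which no `p`-adic `L`-function on this line interpolates), and the moving channel meets the BDP range `j ≥ 1` (sign `+1`,
`L(f/K,χ_j,1) ≠ 0` generically).  So `𝐳 ≠ 0`; it is NOT in `S_(∅,0)` (its `loc_𝔭'` is read by the symmetric `𝐠'`-law as
`C·ι(L) ≠ 0`), consistent with (S1); its specialisations are non-crystalline at the `j ≥ 1` points (consistent with (S3))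
and Selmer at the torsion points, where `𝐳(𝟙) = √C·y_K` up to units (`(L_p^𝐠)²(0,0) = 𝓛(ν)·𝓛(𝟙) ∝ log²(y_ν)·log²(y_K)`):
the class is a Λ_ac-adic AVATAR OF THE HEEGNER CLASS that the trace-zero tower (`TraceZeroHeegnerTowerAtAdditiveSplitP`)
forbids to build from CM points — the half-logarithm-type defect sits in `fudge` (the local factor at 3, F-g8-1).
The analogy that misled gen 8 (Agboola–Howard/Rubin: Katz's function vanishes identically on a sign-`−1` line) requires
EVERY point of the line to be a central critical INTERPOLATION point of sign `−1`; our line has no such points.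
On the DIAGONAL `v = 0` (balanced classical points `(2,l,l)` dense) the roles swap: channel B is frozen at `𝟙`, channel A
moves through the BDP range and its component IS forced to vanish identically (geometric ⇒ Selmer in a rank-0 Selmer
group, Bloch–Kato) — that is where a DERIVED class lives (Castella–Hsieh generalised Kato classes), not on `u = 0`.

## B-g9-2 — the naive sharp Λ_ac-adic bound is FALSE for τ-asymmetric structures fed by RING-class systems (barrier note)
Ordinary Heegner model: `G = (Gr_𝔭, ∅_𝔭')`, `κ_∞ = b·s ∈ S_G = S_(Gr,Gr) = Λs`, `loc_𝔭' s = c·(generator of H¹_Gr)`,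
Howard/Perrin-Riou `char X_(Gr,Gr),tors = b²` ⟹ `char X_{G*} = char X_(Gr,0) = c·b²`, while `ind(κ_∞; S_G) = b`: the
"core-rank-one bound `char X_{G*} ∣ ind`" would force `b, c` units.  Resolution: Heegner classes live over RING class
fields (inert Kolyvagin primes, local conditions of rank 2 split by `τ` — needs `G^τ = G`); a `τ`-asymmetric `G` needs
SPLIT Kolyvagin primes `ℓ = λλ̄` and classes over RAY class directions `K(λⁿ)` (JNS), which diagonal/BF classes have (CD
Prop. 2.3.1) and Heegner points do not.  Every content-bound leaf on this crux (g8-A, g9-A) must therefore be the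
SPLIT-prime machine; ask A-g9-1: its admissibility at `p = 3` (`GL₂(𝔽₃)` solvable; `H¹(GL₂(𝔽₃), 𝔽₃²)`; `27 ∣ N`) and
for a local condition `L_𝔭 = Λℓ` that is saturated but not necessarily a direct summand at the height-2 prime `(3,T)`.

INSTRUMENT DATA CITED: none new since gen 5 (no instrument/vet output after VET-UTDR3 g0/g1; asks F-g8-1, A-g8-1,
D-g7-1/2/3, F1, D-g6-1, D-g5-1, D-g2-1/2 unrun).  This node's asks: A-g9-1 (above), F-g8-1 (now load-bearing for `fudge`
being zero-free on `u = 0`), L-g9-1 (literature: a big dual exponential over a height-one Lubin–Tate `ℤ₃`-tower of `ℚ₃`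
for de Rham `V`, tempered of order = slope), E-g9-1 (does BSV's `Det` at level `Γ₀(27)` with trivial `f`-coefficients
give an integral two-variable class — E1').  Disproof.lean for this crux: none on file (nothing to honour).
-/

set_option linter.dupNamespace false

open scoped Classical

namespace Summit.BirchSwinnertonDyer.BirchSwinnertonDyer.Cruxes.RationalSplitIMCInclusionAtThree.FrozenChannelPadicPin

open PowerSeries Literature.NumberTheory.EllipticCurves Summit.BirchSwinnertonDyer.Rank1Residual.X11b

/-! ## Root-wise vocabulary (verbatim currency of the gen-6 and gen-8 nodes) -/

/-- `G` vanishes to order `≥ n` at the point `x` of the open disc: `G^{(i)}(x) = 0` for `i < n` (formal derivatives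
over `R₀`, values via the tree's `UnrSeries.HasValueAt`). [gen-6 node, verbatim] -/
def VanishesToOrder (G : UnrSeries 3) (x : ℂ_[3]) (n : ℕ) : Prop :=
  ∀ i < n, ((fun H : UnrSeries 3 ↦ PowerSeries.derivative (unrIntegers 3) H)^[i] G).HasValueAt x 0

/-- The root-wise order inequality `ord_x L ≥ ord_x F` on the open unit disc of `ℂ₃`. [gen-6 node, verbatim] -/
def RootwiseDominates (F L : UnrSeries 3) : Prop :=
  ∀ x : ℂ_[3], ‖x‖ < 1 → ∀ n : ℕ, VanishesToOrder F x n → VanishesToOrder L x n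

/-- `F` and `M` have no common zero in the open unit disc of `ℂ₃`. [gen-8 node, verbatim] -/
def RootDisjoint (F M : UnrSeries 3) : Prop :=
  ∀ x : ℂ_[3], ‖x‖ < 1 → F.HasValueAt x 0 → ¬ M.HasValueAt x 0

/-- **R [WEAKER · ATTACKABLE (M) · shared with gen 6]** the root-wise door: `F ≠ 0` and `ord_x F ≤ ord_x L` on the open
disc imply `F ∣ 3ᵏ·L` in `R₀⟦T⟧` (Weierstrass preparation `F = 3^μ·P·u`, division by the distinguished `P`; `k = μ`).
[Washington GTM 83 §7.1; Lazard 1962] -/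
def RootwiseDoor : Prop :=
  ∀ F L : UnrSeries 3, F ≠ 0 → RootwiseDominates F L → ∃ k : ℕ, ((3 : ℕ) : UnrSeries 3) ^ k * L ∈ Ideal.span {F}

/-- **Rc [WEAKER · ATTACKABLE (S) · shared with gen 6]** `3ᵏ·G ∈ (F)` ⟹ `ord_x F ≤ ord_x G` (Leibniz; the constant
`3ᵏ` has no zero in the disc). -/
def RootwiseDoorConverse : Prop :=
  ∀ F G : UnrSeries 3, (∃ k : ℕ, ((3 : ℕ) : UnrSeries 3) ^ k * G ∈ Ideal.span {F}) → RootwiseDominates F G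

/-- **St [WEAKER · ATTACKABLE (M)]** root-wise coprime stripping: if `ord_x F ≤ ord_x (M·L)` on the open disc and `M`
does not vanish at any disc zero of `F`, then `ord_x F ≤ ord_x L` (`ord_x(M·L) = ord_x M + ord_x L` over the field `ℂ₃`
by Leibniz, and `ord_x M = 0` wherever `F(x) = 0`; where `F(x) ≠ 0` the hypothesis `VanishesToOrder F x n` forces
`n = 0`). -/
def RootwiseCoprimeStripping : Prop :=
  ∀ F L M : UnrSeries 3, RootDisjoint F M → RootwiseDominates F (M * L) → RootwiseDominates F L

/-- **P [WEAKER · ATTACKABLE (M) · ASIDE — feeds producer step (P) "the pin is free"; not used by the composition]**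
a nonzero element of `R₀⟦T⟧` has finitely many zeros in the open unit disc of `ℂ₃` (Weierstrass preparation over the
complete DVR `R₀`; units of `R₀⟦T⟧` do not vanish on the open disc).  Applied to the `ν`-branch BDP function it pins
`C = 𝓛^{BDP}_ν(ν_wild) ≠ 0` for all but finitely many `3`-power-order `ν_wild`. [Washington GTM 83 §7.1] -/
def DiscZerosFinite : Prop :=
  ∀ G : UnrSeries 3, G ≠ 0 → {x : ℂ_[3] | ‖x‖ < 1 ∧ G.HasValueAt x 0}.Finite

/-- **S9 [UNDECIDED · door-half · EQUIV-mod-(R,Rc,St)]** pinned content supply: on the wall's binders, with `X_(∅,0)`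
torsion and `Ch_Λ(X)·R₀⟦T⟧ = (F)`, there are `a`, a content `c` and a cofactor `M` root-disjoint from `F` with
`3ᵃ·c ∈ (F)` and `ord_x c ≤ ord_x(M·L)` on the open disc.  Informal producer: the UN-derived frozen-channel class `𝐳`
with (A) `char X ∣ 3ᵃ·cont_𝔭(𝐳)` (`c := cont_𝔭(𝐳)`), (R)+(F) `λ_ω(loc_𝔭 𝐳)² = C·fudge·L` (`M := C·fudge|_{u=0}`,
`C ≠ 0` by (P), `fudge` zero-free by F-g8-1).  Leaves: A UNDECIDED/IDEA-NEEDED (shape, A-g9-1), R IDEA-NEEDED (hardest),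
F ATTACKABLE (L) mod LEAD K3a♯ + INSTRUMENTABLE (F-g8-1), E1' IDEA-NEEDED (shared g8), P ATTACKABLE (M), S1 paper-proved. -/
def PinnedContentSupplyAtThree : Prop :=
  ∀ (W : WeierstrassCurve ℚ) [W.IsElliptic] [W.IsGloballyMinimal] (N : ℕ) [NeZero N] (K : Type) [Field K] [NumberField K] (Dt : Literature.NumberTheory.EllipticCurves.ModularForms.ModularParametrizationData W N), Summit.BirchSwinnertonDyer.Rank1Residual.Additive.ClassO6 W 3 → W.HasSurjectiveModNGaloisRep 3 → W.analyticRank = 1 → W.conductorNorm ℤ = N → Literature.NumberTheory.EllipticCurves.IsImaginaryQuadratic K → Literature.NumberTheory.EllipticCurves.SatisfiesHeegnerHypothesis N K → ∀ (κ : Literature.NumberTheory.EllipticCurves.ZpExtension K 3), κ.IsAnticyclotomic → ∀ (γ : Field.absoluteGaloisGroup K) [Fact (κ.IsTopGenerator γ)] (𝔭 : IsDedekindDomain.HeightOneSpectrum (NumberField.RingOfIntegers K)), ((3 : ℕ) : NumberField.RingOfIntegers K) ∈ 𝔭.asIdeal → 𝔭.asIdeal.ramificationIdx (NumberField.RingOfIntegers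 ℚ) = 1 → 𝔭.asIdeal.inertiaDeg (NumberField.RingOfIntegers ℚ) = 1 → ∀ (𝔭' : IsDedekindDomain.HeightOneSpectrum (NumberField.RingOfIntegers K)), ((3 : ℕ) : NumberField.RingOfIntegers K) ∈ 𝔭'.asIdeal → 𝔭' ≠ 𝔭 → ∀ (ι' : PadicAlgCl 3 ≃+* ℂ), Summit.BirchSwinnertonDyer.BirchSwinnertonDyer.Theorems.SchneiderFree.BranchInducesPrime 3 ι' 𝔭 → ∀ (ΩK : ℂ) (Ωp : ℂ_[3]) (L : Literature.NumberTheory.EllipticCurves.UnrSeries 3), ΩK ≠ 0 → Ωp ≠ 0 → Literature.NumberTheory.EllipticCurves.IsBDPLFunction ι' 𝔭 κ γ Dt.f ΩK Ωp L → Module.IsTorsion (Literature.NumberTheory.EllipticCurves.IwasawaAlgebra 3) (Summit.BirchSwinnertonDyer.Rank1Residual.X11b.AcSelmer.XAc (W.baseChange K) 3 κ 𝔭' ∅ γ) → ∀ F : Literature.NumberTheory.EllipticCurves.UnrSeries 3, (Summit.BirchSwinnertonDyer.Rank1Residual.X11b.AcSelmer.XAc.charIdeal (W.baseChange K) 3 κ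 𝔭' ∅ γ).map (PowerSeries.map (Summit.BirchSwinnertonDyer.Rank1Residual.X11b.Halves.toUnr 3)) = Ideal.span {F} →
    ∃ (a : ℕ) (c M : Literature.NumberTheory.EllipticCurves.UnrSeries 3),
      RootDisjoint F M ∧ ((3 : ℕ) : Literature.NumberTheory.EllipticCurves.UnrSeries 3) ^ a * c ∈ Ideal.span {F} ∧
        RootwiseDominates c (M * L)

/-! ## Helper facts -/

/-- Root-wise domination is transitive. -/
theorem RootwiseDominates.trans {F G H : UnrSeries 3} (h₁ : RootwiseDominates F G) (h₂ : RootwiseDominates G H) :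
    RootwiseDominates F H :=
  fun x hx n hF ↦ h₂ x hx n (h₁ x hx n hF)

/-- Root-wise domination is reflexive. -/
theorem RootwiseDominates.refl (F : UnrSeries 3) : RootwiseDominates F F := fun _ _ _ h ↦ h

/-- The extended characteristic ideal is principal: `Ch_Λ(X)·R₀⟦T⟧ = (F)`. [gen-3…8 nodes, verbatim] -/
theorem exists_map_charIdeal_eq_span {K : Type} [Field K] [NumberField K] (W : WeierstrassCurve K)
    (κ : ZpExtension K 3) (𝔭' : IsDedekindDomain.HeightOneSpectrum (NumberField.RingOfIntegers K))
    (γ : Field.absoluteGaloisGroup K) [Fact (κ.IsTopGenerator γ)] :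
    ∃ F : UnrSeries 3, (AcSelmer.XAc.charIdeal W 3 κ 𝔭' ∅ γ).map (PowerSeries.map (Halves.toUnr 3)) =
      Ideal.span {F} := by
  obtain ⟨f, hf⟩ := (charIdeal_isPrincipal_holds 3 (AcSelmer.XAc W 3 κ 𝔭' ∅ γ)).principal
  refine ⟨PowerSeries.map (Halves.toUnr 3) f, ?_⟩
  have hf' : AcSelmer.XAc.charIdeal W 3 κ 𝔭' ∅ γ = Ideal.span {f} := by
    change Literature.NumberTheory.EllipticCurves.Module.charIdeal (IwasawaAlgebra 3) (AcSelmer.XAc W 3 κ 𝔭' ∅ γ) =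
      Ideal.span {f}
    simpa [Ideal.submodule_span_eq] using hf
  rw [hf', Ideal.map_span, Set.image_singleton]

/-- The extended characteristic ideal is nonzero. [gen-3…8 nodes, verbatim] -/
theorem map_charIdeal_ne_bot {K : Type} [Field K] [NumberField K] (W : WeierstrassCurve K)
    (κ : ZpExtension K 3) (𝔭' : IsDedekindDomain.HeightOneSpectrum (NumberField.RingOfIntegers K))
    (γ : Field.absoluteGaloisGroup K) [Fact (κ.IsTopGenerator γ)] :
    (AcSelmer.XAc.charIdeal W 3 κ 𝔭' ∅ γ).map (PowerSeries.map (Halves.toUnr 3)) ≠ ⊥ := by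
  rw [Ne, Ideal.map_eq_bot_iff_of_injective map_toUnr_injective]
  exact Literature.NumberTheory.EllipticCurves.Module.charIdeal_ne_bot (IwasawaAlgebra 3) _

/-- The constant series `1` takes the value `1` at every point of the disc. [gen-8 node, verbatim] -/
theorem one_hasValueAt (x : ℂ_[3]) : (1 : UnrSeries 3).HasValueAt x 1 := by
  have h := hasSum_single (f := fun k : ℕ ↦
      ((PowerSeries.coeff k (1 : UnrSeries 3) : unrIntegers 3) : ℂ_[3]) * x ^ k) 0
    (fun k hk ↦ by simp [PowerSeries.coeff_one, hk])
  simpa [UnrSeries.HasValueAt, PowerSeries.coeff_one] using h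

/-- The cofactor `1` is root-disjoint from anything. [gen-8 node, verbatim] -/
theorem rootDisjoint_one (F : UnrSeries 3) : RootDisjoint F 1 :=
  fun x _ _ h1 ↦ one_ne_zero ((one_hasValueAt x).unique h1)

/-! ## The composition (kernel, BY NAME) and the costume check -/

/-- **S9 ∧ R ∧ Rc ∧ St ⟹ 24207.**  If `X_(∅,0)` is not Λ-torsion its characteristic ideal is `⊤` (`k = 0`).  Otherwise
`Ch·R₀⟦T⟧ = (F)`, `F ≠ 0`; S9 gives `3ᵃ·c ∈ (F)`, `ord c ≤ ord(M·L)`, `M` root-disjoint from `F`; **Rc** turns the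
divisibility into `ord F ≤ ord c`, transitivity gives `ord F ≤ ord(M·L)`, **St** strips `M`, and **R** converts
`ord F ≤ ord L` into `F ∣ 3ᵏ·L`. -/
theorem rationalSplitIMCInclusionAtThree_of_pinnedSupply
    (hS : PinnedContentSupplyAtThree) (hR : RootwiseDoor) (hRc : RootwiseDoorConverse)
    (hSt : RootwiseCoprimeStripping) :
    Summit.BirchSwinnertonDyer.BirchSwinnertonDyer.Theses.UniversalToricDescent.RationalSplitIMCInclusionAtThree := by
  intro W _ _ N _ K _ _ Dt hO6 hsurj hr1 hN hK hH κ hκ γ _ 𝔭 h𝔭 he hf 𝔭' h𝔭' hne ι' hι ΩK Ωp L hΩK hΩp hL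
  by_cases htor : Module.IsTorsion (IwasawaAlgebra 3) (AcSelmer.XAc (W.baseChange K) 3 κ 𝔭' ∅ γ)
  · obtain ⟨F, hF⟩ := exists_map_charIdeal_eq_span (W.baseChange K) κ 𝔭' γ
    have hF0 : F ≠ 0 := by
      intro h0
      apply map_charIdeal_ne_bot (W.baseChange K) κ 𝔭' γ
      rw [hF, h0, Ideal.span_singleton_eq_bot]
    obtain ⟨a, c, M, hdisj, hdiv, hdom⟩ := hS W N K Dt hO6 hsurj hr1 hN hK hH κ hκ γ 𝔭 h𝔭 he hf 𝔭' h𝔭' hne ι' hι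
      ΩK Ωp L hΩK hΩp hL htor F hF
    have h1 : RootwiseDominates F c := hRc F c ⟨a, hdiv⟩
    have h2 : RootwiseDominates F (M * L) := h1.trans hdom
    have h3 : RootwiseDominates F L := hSt F L M hdisj h2
    obtain ⟨k, hk⟩ := hR F L hF0 h3
    exact ⟨k, by rw [hF]; exact hk⟩
  · refine ⟨0, ?_⟩
    have htop : AcSelmer.XAc.charIdeal (W.baseChange K) 3 κ 𝔭' ∅ γ = ⊤ :=
      Summit.BirchSwinnertonDyer.BirchSwinnertonDyer.Theorems.charIdeal_eq_top_of_not_isTorsion (p := 3) _ htor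
    rw [htop, Ideal.map_top]; exact Submodule.mem_top

/-- **Costume check (evidence for the EQUIV-mod-doors tag of S9):** the wall gives S9 with `c = L`, `M = 1`, `a = k`.
So S9 carries content only through its informal producer (the un-derived frozen-channel class); the typed decomposition
is a chain of root-wise DOORS, each strictly weaker than the wall (pure `R₀⟦T⟧`-algebra). -/
theorem pinnedContentSupply_of_wall
    (h : Summit.BirchSwinnertonDyer.BirchSwinnertonDyer.Theses.UniversalToricDescent.RationalSplitIMCInclusionAtThree) :
    PinnedContentSupplyAtThree := by
  intro W _ _ N _ K _ _ Dt hO6 hsurj hr1 hN hK hH κ hκ γ _ 𝔭 h𝔭 he hf 𝔭' h𝔭' hne ι' hι ΩK Ωp L hΩK hΩp hL _ F hF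
  obtain ⟨k, hk⟩ := h W N K Dt hO6 hsurj hr1 hN hK hH κ hκ γ 𝔭 h𝔭 he hf 𝔭' h𝔭' hne ι' hι ΩK Ωp L hΩK hΩp hL
  refine ⟨k, L, 1, rootDisjoint_one F, ?_, ?_⟩
  · rw [← hF]; exact hk
  · rw [one_mul]; exact RootwiseDominates.refl L

end Summit.BirchSwinnertonDyer.BirchSwinnertonDyer.Cruxes.RationalSplitIMCInclusionAtThree.FrozenChannelPadicPin
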